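import Summits.ResolutionOfSingularities.ResolutionOfSingularities.Theorems.PurelyInseparableDim4AtlasOwnedSets
import Summits.ResolutionOfSingularities.ResolutionOfSingularities.Theorems.PurelyInseparableDim4AtlasMemberBasics
import HarnessLib

/-!
# Purely inseparable four-folds: the DEFERRAL SETS of the child readings and their owned subspaces (brick S3 (c) v4, tranche 1, brick A1d;
# cell `res-dim4-pi`)

[OURS · counted 0] (D-0157 DOOR 2; host item stmt-ResolutionOfSingularities-16155, helper). Nothing here proves resolution of
singularities in dimension ≥ 4 / characteristic `p`. For a parent reading WITHOUT deferrals (`X = ∅`: root hosts, main readings) the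
child readings of an entry `e = (j, b, S″)` own: the main reading ALL of `V(z, x_{S″})`; the extra reading on chart `l` the part of
`V(z, x_{T_l})`, `T_l = insert l (S″ ∖ {j})`, where `x_j = 0` and `x_{l′} = 0` for the earlier extra charts `l′ < l` — literally the owned
pieces of `owned_pieces_cover` (A1a p711726) for the ranking «`j` first, then by index».

* `shiftDefer_empty`, `mainReading_defer_of_empty`, `extraReading_defer_of_empty`, **`ownedSetZ_mainReading_of_empty`**,
  **`ownedSetZ_extraReading_of_empty`**.

AI-produced formalisation, weaker than expert review. bears_on: LADDER-RESOLUTION:D157-DOOR2 (res-dim4-pi · S3 (c) v4 A1d).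
-/

set_option linter.dupNamespace false -- D-0017: single-problem summit path `Summit.<S>.<S>.…` by design

noncomputable section

open MvPolynomial Finset CategoryTheory AlgebraicGeometry Opposite TopologicalSpace

namespace Summit.ResolutionOfSingularities.ResolutionOfSingularities.Theorems.PIDim4

open Literature.AlgebraicGeometry.Resolution
open Literature.AlgebraicGeometry.Resolution.Hauser2010
open Literature.AlgebraicGeometry.Resolution.AffinePointBlowup (P A γ coord Wtop ξ)

namespace Equimultiple

section Deferrals

variable {K : Type} [Field K] (p : ℕ) [DecidableEq K]

/-- Shifting no deferrals gives no deferrals. [folklore] -/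
theorem shiftDefer_empty (b : Fin 4 → K) (S'' : Finset (Fin 4)) : shiftDefer b S'' (∅ : Finset (Fin 4 × K)) = ∅ := by
  simp [shiftDefer]

/-- The main reading of a deferral-free reading is deferral-free. [folklore] -/
theorem mainReading_defer_of_empty (s : State K) (T D : Finset (Fin 4)) (e : Fin 4 × (Fin 4 → K) × Finset (Fin 4)) :
    (mainReading p (s, T, (∅ : Finset (Fin 4 × K)), D) e).2.2.1 = ∅ := by
  change shiftDefer e.2.1 e.2.2 ∅ = ∅
  exact shiftDefer_empty _ _

/-- The deferral set of an extra reading of a deferral-free reading: `(j, 0)` and `(l′, 0)` for the earlier extra charts. [folklore] -/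
theorem extraReading_defer_of_empty (s : State K) (T D : Finset (Fin 4)) (e : Fin 4 × (Fin 4 → K) × Finset (Fin 4)) (l : Fin 4) :
    (extraReading p (s, T, (∅ : Finset (Fin 4 × K)), D) e l).2.2.1 =
      insert (e.1, (0 : K)) (((T \ e.2.2).filter fun l' => l' < l).image fun l' => (l', (0 : K))) := by
  change shiftDefer e.2.1 (insert l (e.2.2.erase e.1)) ∅ ∪ _ = _
  rw [shiftDefer_empty, Finset.empty_union]

/-- **The main reading of a deferral-free reading owns all of `V(z, x_{S″})`.** [cite: BierstoneGrigorievMilmanWlodarczyk2011, Def. 3.1.3 (4)] -/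
theorem ownedSetZ_mainReading_of_empty (s : State K) (T D : Finset (Fin 4)) (e : Fin 4 × (Fin 4 → K) × Finset (Fin 4)) :
    ownedSetZ (mainReading p (s, T, (∅ : Finset (Fin 4 × K)), D) e).2.1 (mainReading p (s, T, (∅ : Finset (Fin 4 × K)), D) e).2.2.1 =
      (AffineCoordBlowup.CΛ 4 K (insert 0 (Fin.succ '' (e.2.2 : Set (Fin 4)))) : Set (P 4 K)) := by
  rw [mainReading_defer_of_empty]
  exact ownedSetZ_empty _

/-- **The extra reading on chart `l` of a deferral-free reading owns the part of `V(z, x_{T_l})` invisible to the chart `j` and to the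
earlier extra charts**: `x_j = 0` and `x_{l′} = 0` for `l′ ∈ T ∖ S″`, `l′ < l`. [cite: BierstoneGrigorievMilmanWlodarczyk2011, Def. 3.1.3 (4)] -/
theorem ownedSetZ_extraReading_of_empty (s : State K) (T D : Finset (Fin 4)) (e : Fin 4 × (Fin 4 → K) × Finset (Fin 4)) (l : Fin 4) :
    ownedSetZ (extraReading p (s, T, (∅ : Finset (Fin 4 × K)), D) e l).2.1
        (extraReading p (s, T, (∅ : Finset (Fin 4 × K)), D) e l).2.2.1 =
      (AffineCoordBlowup.CΛ 4 K (insert 0 (Fin.succ '' ((insert l (e.2.2.erase e.1) : Finset (Fin 4)) : Set (Fin 4)))) : Set (P 4 K)) ∩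
        {x : P 4 K | (X e.1.succ : A 4 K) ∈ x.asIdeal ∧ ∀ l' ∈ T \ e.2.2, l' < l → (X l'.succ : A 4 K) ∈ x.asIdeal} := by
  rw [extraReading_defer_of_empty]
  have h : insert (e.1, (0 : K)) (((T \ e.2.2).filter fun l' => l' < l).image fun l' => (l', (0 : K))) =
      (insert e.1 ((T \ e.2.2).filter fun l' => l' < l)).image fun l' => (l', (0 : K)) := by
    rw [Finset.image_insert]
  rw [h]
  change ownedSetZ (insert l (e.2.2.erase e.1)) _ = _
  rw [ownedSetZ_image_zero]
  congr 1
  ext x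
  simp only [Set.mem_setOf_eq, Finset.mem_insert, Finset.mem_filter, forall_eq_or_imp, and_imp]

end Deferrals

end Equimultiple

end Summit.ResolutionOfSingularities.ResolutionOfSingularities.Theorems.PIDim4

end
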